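import Literature.Analysis.TotalPositivity.PolyaFrequencyProductEstimates
import Mathlib.RingTheory.Polynomial.Vieta
import Mathlib.Algebra.Polynomial.HasseDeriv
import HarnessLib

/-!
# Linear factors of the scaled Jensen polynomials (Schoenberg 1951, necessity half, step N4a)

Trunk `Literature/Analysis/TotalPositivity`, fifteenth proofs file accompanying
`PolyaFrequencyFunctions.lean` (the named fact `schoenberg1951_pf_laplace`).  This is the first,
purely algebraic, step of the Pólya–Schur/Laguerre–Pólya argument: let `γ : ℕ → ℝ` with `γ₀ = 1`
be such that the reversed Jensen polynomial `q_n = Σ_{k≤n} γ_k H_k(X^n) = Σ_k C(n,k) γ_k X^{n-k}`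
has `n` real roots `r_{n,1}, …, r_{n,n}`.  With `a_{n,i} = -r_{n,i}/n` (Vieta),

* `∏_i (1 + a_{n,i} z) = Σ_{k≤n} C(n,k) γ_k n^{-k} z^k` for all complex `z` (this is `g_n(z/n)` for the
  Jensen polynomial `g_n(x) = Σ_k C(n,k) γ_k x^k`),
* `Σ_i a_{n,i} = γ_1` and `Σ_i a_{n,i}^2 = γ_1^2 − (1 − 1/n) γ_2`

(`exists_linear_factors`).  [Schoenberg1951, §9; Pólya–Schur 1914]

## References

* I. J. Schoenberg, *On Pólya frequency functions. I*, J. Analyse Math. 1 (1951) 331–374, §9.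
  [Schoenberg1951]
* G. Pólya, I. Schur, *Über zwei Arten von Faktorenfolgen in der Theorie der algebraischen
  Gleichungen*, J. reine angew. Math. 144 (1914) 89–113. [folklore]
-/

noncomputable section

open Finset Polynomial
open scoped Polynomial

namespace Literature.Analysis.TotalPositivity

/-! ### The reversed Jensen polynomial `Σ_k γ_k H_k(X^n)` -/

/-- `H_k(X^n) = C(n,k) X^{n-k}`. [folklore] -/
theorem hasseDeriv_X_pow' (n k : ℕ) :
    hasseDeriv k (X ^ n : ℝ[X]) = monomial (n - k) ((n.choose k : ℕ) : ℝ) := by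
  rw [X_pow_eq_monomial, hasseDeriv_monomial, mul_one]

/-- Coefficients of the reversed Jensen polynomial. [folklore] -/
theorem coeff_jensenSum (γ : ℕ → ℝ) (n : ℕ) {m : ℕ} (hm : m ≤ n) :
    (∑ k ∈ Finset.range (n + 1), γ k • hasseDeriv k (X ^ n : ℝ[X])).coeff m =
      (n.choose (n - m) : ℝ) * γ (n - m) := by
  simp only [hasseDeriv_X_pow', finsetSum_coeff, coeff_smul, coeff_monomial, smul_eq_mul, mul_ite,
    mul_zero]
  rw [Finset.sum_eq_single (n - m)]
  · rw [if_pos (by omega)]; ring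
  · intro k hk hkm
    rw [if_neg]
    intro h
    apply hkm
    simp only [Finset.mem_range] at hk
    omega
  · intro h
    simp only [Finset.mem_range] at h
    omega

/-- The reversed Jensen polynomial has degree `≤ n`. [folklore] -/
theorem natDegree_jensenSum_le (γ : ℕ → ℝ) (n : ℕ) :
    (∑ k ∈ Finset.range (n + 1), γ k • hasseDeriv k (X ^ n : ℝ[X])).natDegree ≤ n := by
  refine Polynomial.natDegree_sum_le_of_forall_le _ _ fun k _ => ?_
  refine (natDegree_smul_le _ _).trans ?_
  rw [hasseDeriv_X_pow']
  exact (natDegree_monomial_le _).trans (Nat.sub_le _ _)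

/-- For `γ₀ = 1` the reversed Jensen polynomial has degree exactly `n`. [folklore] -/
theorem natDegree_jensenSum {γ : ℕ → ℝ} (hγ0 : γ 0 = 1) (n : ℕ) :
    (∑ k ∈ Finset.range (n + 1), γ k • hasseDeriv k (X ^ n : ℝ[X])).natDegree = n := by
  refine natDegree_eq_of_le_of_coeff_ne_zero (natDegree_jensenSum_le γ n) ?_
  rw [coeff_jensenSum γ n le_rfl, Nat.sub_self, hγ0, Nat.choose_zero_right]
  norm_num

/-- For `γ₀ = 1` the reversed Jensen polynomial is monic. [folklore] -/
theorem monic_jensenSum {γ : ℕ → ℝ} (hγ0 : γ 0 = 1) (n : ℕ) :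
    (∑ k ∈ Finset.range (n + 1), γ k • hasseDeriv k (X ^ n : ℝ[X])).Monic := by
  rw [Monic, leadingCoeff, natDegree_jensenSum hγ0, coeff_jensenSum γ n le_rfl, Nat.sub_self, hγ0,
    Nat.choose_zero_right]
  norm_num

/-! ### Elementary symmetric functions -/

/-- `e_1(s) = Σ s`. [folklore] -/
theorem esymm_one_eq_sum {R : Type*} [CommSemiring R] (s : Multiset R) : s.esymm 1 = s.sum := by
  simp [Multiset.esymm, Multiset.powersetCard_one, Multiset.map_map]

/-- Newton's identity `p_2 = e_1^2 - 2 e_2`. [folklore] -/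
theorem sum_map_sq_eq {R : Type*} [CommRing R] (s : Multiset R) :
    (s.map fun a => a ^ 2).sum = s.sum ^ 2 - 2 * s.esymm 2 := by
  induction s using Multiset.induction_on with
  | empty =>
    simp [Multiset.esymm]
  | cons a s ih =>
    have h2 : (a ::ₘ s).esymm 2 = s.esymm 2 + a * s.esymm 1 := by
      simp only [Multiset.esymm, show (2 : ℕ) = 1 + 1 from rfl, Multiset.powersetCard_cons,
        Multiset.map_add, Multiset.sum_add, Multiset.map_map, Function.comp_def, Multiset.prod_cons]
      rw [Multiset.sum_map_mul_left]
    rw [Multiset.map_cons, Multiset.sum_cons, Multiset.sum_cons, h2, esymm_one_eq_sum, ih]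
    ring

/-- A multiset with `n` elements is enumerated by `Fin n`. [folklore] -/
theorem exists_fin_enum {Y : Type*} (s : Multiset Y) {n : ℕ} (hs : Multiset.card s = n) :
    ∃ r : Fin n → Y, Finset.univ.val.map r = s := by
  induction s using Quotient.inductionOn with
  | h l =>
    have hl : l.length = n := by simpa using hs
    subst hl
    exact ⟨l.get, by rw [Fin.univ_val_map, List.ofFn_get]; rfl⟩

/-- Sums over an enumeration are multiset sums. [folklore] -/
theorem sum_univ_eq_multiset_sum {Y M : Type*} [AddCommMonoid M] {n : ℕ} (r : Fin n → Y)
    (f : Y → M) : ∑ i, f (r i) = ((Finset.univ.val.map r).map f).sum := by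
  rw [Finset.sum_eq_multiset_sum, Multiset.map_map]
  rfl

/-- Products over an enumeration are multiset products. [folklore] -/
theorem prod_univ_eq_multiset_prod {Y M : Type*} [CommMonoid M] {n : ℕ} (r : Fin n → Y)
    (f : Y → M) : ∏ i, f (r i) = ((Finset.univ.val.map r).map f).prod := by
  rw [Finset.prod_eq_multiset_prod, Multiset.map_map]
  rfl

/-! ### The linear factors -/

/-- **Linear factors of the scaled Jensen polynomial** (Vieta): if `γ₀ = 1` and the reversed Jensen
polynomial `Σ_{k≤n} γ_k H_k(X^n)` has `n` real roots (`n ≥ 1`), then there are reals `a_1, …, a_n`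
with `∏_i (1 + a_i z) = Σ_{k≤n} C(n,k) γ_k n^{-k} z^k` for all complex `z`, `Σ a_i = γ_1` and
`Σ a_i^2 = γ_1^2 − (1 − 1/n) γ_2`. [cite: Schoenberg1951, §9] -/
theorem exists_linear_factors {γ : ℕ → ℝ} (hγ0 : γ 0 = 1) {n : ℕ} (hn : 0 < n)
    (hreal : Multiset.card
      (∑ k ∈ Finset.range (n + 1), γ k • hasseDeriv k (X ^ n : ℝ[X])).roots = n) :
    ∃ a : Fin n → ℝ,
      (∀ z : ℂ, ∏ i, (1 + (a i : ℂ) * z) =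
        ∑ k ∈ Finset.range (n + 1), (((n.choose k : ℝ) * γ k / (n : ℝ) ^ k : ℝ) : ℂ) * z ^ k) ∧
      ∑ i, a i = γ 1 ∧ ∑ i, a i ^ 2 = γ 1 ^ 2 - (1 - 1 / (n : ℝ)) * γ 2 := by
  classical
  set q : ℝ[X] := ∑ k ∈ Finset.range (n + 1), γ k • hasseDeriv k (X ^ n : ℝ[X]) with hq
  have hdeg : q.natDegree = n := natDegree_jensenSum hγ0 n
  have hmonic : q.Monic := monic_jensenSum hγ0 n
  have hroots : Multiset.card q.roots = q.natDegree := by rw [hdeg]; exact hreal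
  have hn0 : (n : ℝ) ≠ 0 := by exact_mod_cast hn.ne'
  -- Vieta
  have hesymm : ∀ k, k ≤ n → q.roots.esymm k = (-1) ^ k * ((n.choose k : ℝ) * γ k) := by
    intro k hk
    have h1 := Polynomial.coeff_eq_esymm_roots_of_card hroots (k := n - k) (by rw [hdeg]; omega)
    rw [hmonic.leadingCoeff, one_mul, hdeg, show n - (n - k) = k by omega,
      coeff_jensenSum γ n (by omega : n - k ≤ n), show n - (n - k) = k by omega] at h1
    calc q.roots.esymm k = (-1 : ℝ) ^ k * ((-1) ^ k * q.roots.esymm k) := by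
          rw [← mul_assoc, ← mul_pow, neg_mul_neg, one_mul, one_pow, one_mul]
      _ = _ := by rw [← h1]
  have hes1 : q.roots.sum = -((n : ℝ) * γ 1) := by
    rw [← esymm_one_eq_sum, hesymm 1 hn]
    simp
  have hes2 : q.roots.esymm 2 = (n.choose 2 : ℝ) * γ 2 := by
    rcases Nat.lt_or_ge n 2 with h2 | h2
    · have hn1 : n = 1 := by omega
      subst hn1
      rw [Multiset.esymm, Multiset.powersetCard_eq_empty 2 (by rw [hreal]; norm_num)]
      simp
    · rw [hesymm 2 h2]
      norm_num
  -- enumerate the roots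
  obtain ⟨r, hr⟩ := exists_fin_enum q.roots hreal
  refine ⟨fun i => -r i / n, ?_, ?_, ?_⟩
  · -- the product identity
    intro z
    have hqC : ∀ w : ℂ, ∏ i, (w - (r i : ℂ)) =
        ∑ k ∈ Finset.range (n + 1), ((n.choose k : ℝ) * γ k : ℂ) * w ^ (n - k) := by
      intro w
      have hprod := prod_multiset_X_sub_C_of_monic_of_roots_card_eq hmonic hroots
      have hev : (q.map (algebraMap ℝ ℂ)).eval w =
          ∑ k ∈ Finset.range (n + 1), ((n.choose k : ℝ) * γ k : ℂ) * w ^ (n - k) := by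
        rw [Polynomial.eval_map, hq, Polynomial.eval₂_finsetSum]
        refine Finset.sum_congr rfl fun k _ => ?_
        rw [hasseDeriv_X_pow', Polynomial.smul_monomial, Polynomial.eval₂_monomial]
        simp only [smul_eq_mul, Complex.coe_algebraMap, Complex.ofReal_mul, Complex.ofReal_natCast]
        ring
      rw [← hev, ← hprod, Polynomial.map_multiset_prod, Polynomial.eval_multiset_prod,
        Multiset.map_map, Multiset.map_map, ← hr, Multiset.map_map, Finset.prod_eq_multiset_prod]
      congr 1
      refine Multiset.map_congr rfl fun i _ => ?_
      simp
    rcases eq_or_ne z 0 with hz | hz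
    · subst hz
      simp only [mul_zero, add_zero, Finset.prod_const_one]
      rw [Finset.sum_eq_single 0 (fun k _ hk => by rw [zero_pow hk, mul_zero]) (by simp)]
      simp [hγ0]
    · have hzn : z / (n : ℂ) * ((n : ℂ) / z) = 1 := by
        have hn0' : (n : ℂ) ≠ 0 := by exact_mod_cast hn.ne'
        field_simp
      have hfac : ∀ i, (1 + ((-r i / n : ℝ) : ℂ) * z) = z / (n : ℂ) * ((n : ℂ) / z - (r i : ℂ)) := by
        intro i
        have hn0' : (n : ℂ) ≠ 0 := by exact_mod_cast hn.ne'
        push_cast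
        field_simp
        ring
      simp only [hfac]
      rw [Finset.prod_mul_distrib, Finset.prod_const, Finset.card_univ, Fintype.card_fin, hqC,
        Finset.mul_sum]
      refine Finset.sum_congr rfl fun k hk => ?_
      simp only [Finset.mem_range] at hk
      have hk' : k ≤ n := by omega
      have hpow : (z / (n : ℂ)) ^ n * ((n : ℂ) / z) ^ (n - k) = (z / (n : ℂ)) ^ k := by
        have : (z / (n : ℂ)) ^ n = (z / (n : ℂ)) ^ k * (z / (n : ℂ)) ^ (n - k) := by
          rw [← pow_add, Nat.add_sub_cancel' hk']
        rw [this, mul_assoc, ← mul_pow, hzn, one_pow, mul_one]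
      calc (z / (n : ℂ)) ^ n * (((n.choose k : ℝ) * γ k : ℂ) * ((n : ℂ) / z) ^ (n - k))
          = ((n.choose k : ℝ) * γ k : ℂ) * ((z / (n : ℂ)) ^ n * ((n : ℂ) / z) ^ (n - k)) := by
            ring
        _ = ((n.choose k : ℝ) * γ k : ℂ) * (z / (n : ℂ)) ^ k := by rw [hpow]
        _ = _ := by push_cast; rw [div_pow]; ring
  · -- the sum of the `a_i`
    have hsum : ∑ i, r i = -((n : ℝ) * γ 1) := by
      rw [Finset.sum_eq_multiset_sum, hr, hes1]
    rw [← Finset.sum_div, Finset.sum_neg_distrib, hsum]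
    field_simp
  · -- the sum of squares
    have hsq : ∑ i, r i ^ 2 = ((n : ℝ) * γ 1) ^ 2 - 2 * ((n.choose 2 : ℝ) * γ 2) := by
      rw [sum_univ_eq_multiset_sum r (fun a => a ^ 2), hr, sum_map_sq_eq, hes1, hes2, neg_sq]
    have h2 : (n.choose 2 : ℝ) = (n : ℝ) * ((n : ℝ) - 1) / 2 := Nat.cast_choose_two ℝ n
    simp only [div_pow, neg_sq]
    rw [← Finset.sum_div, hsq, h2]
    field_simp

end Literature.Analysis.TotalPositivity
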